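import Summits.QuantumFields.YangMills.Theorems.UnitScaleTiltProp7CombAverageDefect
import HarnessLib

/-!
# Route `UnitScaleTilt`, crux K1 «MinimiserStabilityRegPr» (stmt-QuantumFields-19200), route-R E′ (A′), package P-A4 CURVED, FILE F2 — THE TWO DEFECT ROWS AT A
# PRINTED-REGULAR BACKGROUND for the elementary curved Bernstein on `ker R(U₀)` (LOCATEs px11 g5 «energy minimality + bump×transport competitor» ∕ px19 g5
# «variational principle + bubble competitor»): (κ) in the comb axial gauge from a corner every bond variable is within `|b₋ − c|₁·2ε₀η²` of `1`; (θ) the composite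
# hierarchical transport of print's `Q′_k(U₀)` (lit `trIter`), read in that gauge, is within `θ·ε₀` of the scalar weight `L^{−dk}` — k-UNIFORMLY

Cell `ym3-torus`, width seat `ym3-torus-px11` (g5; explicit-unit helper).  THEOREMS ONLY (0 `def`, 0 `sorry`); `--supports stmt-QuantumFields-19200`, count-neutral.  YM₃ on T³ is a
ladder rung (R3), not the Clay problem; nothing here claims the stub, the crux, `bern_P`, d = 4 or the mass gap.

THE PRINT.  [Balaban1985Averaging] p. 24–25: *«the gauge transformed configuration V₀ = V^{v₀} satisfies the conditions V₀(Γ_{y,x}) = 1 … |V₀(x, x + e₂) − 1| < |x₁ − y₁|α₀ …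
|V₀(Γ_{c,x}) − 1| < |Γ_{c,x}|dLα₀»*; (42)–(43) p. 23–24 and Prop. 2 (52)–(54) p. 26 (the `j`-fold average against the straight transporter: area `α₀(Lʲη)²`, tree
`B7Eq47AveragedBondVsStraight`); [Balaban1985BackgroundPropagators] (3.18)–(3.19) p. 393 (`Q′_j(U) = Q′(Ūʲ⁻¹)⋯Q′(U)`, lit `QprimeIter … (bgT …)`, single-site formula
`QprimeIter_single` with the fibre transport `trIter`); [Balaban1985Variational] (2)∕(6) p. 278 (`𝔘_k(ε₀)`: `|U(∂p) − 1| < ε₀η²`), (21) p. 281 (`R(U₀)D*A = 0`).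

WHY (★p1 g17 WORDS 15–17, ★★OWNER RULING g28-№15, ★w2-19200 g7 RULING (27) «COMB for the (A′) lane», px12 g5 02:39Z «F2 = px11»).  The curved crude slice ∕ `bern_P` for the
COMB pair is elementary: `f ∈ ker R(U₀)` minimises `‖D_{U₀}·‖` in its `ker Q′_k(U₀)`-coset (px19 V1), and the bump×comb-transport competitor has energy `≤ C_P‖f‖²` once two DEFECT
ROWS hold at the background — the comb-gauge flatness (κ) (the «ribbon» term, one power of `η`) and the smallness (θ) of `M_y − m` (the per-block 3×3 re-targeting).  This file proves
both at every `U₀ ∈ RegPr(ε₀)` from lit's certified (24)∕(43)∕(52)–(54) and the tree-gauge ladder — NO propagator, NO Combes–Thomas, NO N06.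

WHAT IS PROVED (ns `…Theorems.Prop7CombDefectRowsOfRegPr`; `V : LSite 3 → Fin 3 → (M₂(ℂ))ˣ` an `SU(2)`-valued field on `ℤ³` in print's class (52), then the member's based pullback).
* (the generic induction `Q′_k(φ•X)(y) = m•X + O(Σ2τ_j)` and the word∕block bookkeeping are ✓`…Prop7CombAverageDefect`, FILE F2a.)
* §2 at a (52)-class field in the comb axial gauge `V₀ := (axialFn V c)•V`, `c = Lᵏ•y`: ★`norm_gaugeAct_axialFn_sub_one_le` ((κ), every bond), `norm_avgIter_axial_sub_one_le` (the averaged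
  bonds of `V₀`: affine law `A_j + B_j|w − L^{k−j}y|₁`), `norm_bgT_axial_sub_one_le` (the block transporters), ★★`norm_QprimeIter_axial_smul_sub_le` ((θ), k-uniform: the level sum is
  `Σ_{j<k}Lʲ∕Lᵏ ≤ 1` because the defects are AREAS `α₀(Lʲη)²`).
* §3 member corollaries under `RegPr F n K ε₀ U₀` (`V := pull (bgUnits F K U₀) x₀`, `α₀ = 2ε₀`): ★`norm_gaugeAct_axialFn_pull_sub_one_le_of_regPr` (κ), ★★`norm_QprimeIter_axial_smul_sub_le_of_regPr` (θ, bump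
  form: `‖Q′_k[V₀](φ•X)(y) − m•X‖ ≤ θ(d,L)·2ε₀·m·‖X‖`, `θ(d,L) = 2dL(256(d+1)(d+4) + 1 + d(L+1))`), ★`QprimeIter_axial_eq_conjR` ((θ′): `Q′_k[V₀](φ•X)(y) = Q′_k[V](φ•R(σ)⁻¹X)(y)`).
HONEST SCOPE.  Small-field bookkeeping over the tree's certified lit estimates; constants generous and explicit; nothing of print beyond them is asserted.

References: T. Bałaban, CMP **98** (1985) 17–51 [Balaban1985Averaging] (pp.24–25, (42)–(43), (52)–(54)); CMP **99** (1985) 389–434 [Balaban1985BackgroundPropagators] ((3.18)–(3.21)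
pp.393–394); CMP **102** (1985) 277–309 [Balaban1985Variational] ((2), (6) p.278, (21) p.281).
-/

set_option autoImplicit false

noncomputable section

namespace Summit.QuantumFields.YangMills.Theorems.Prop7CombDefectRowsOfRegPr

open scoped Matrix.Norms.L2Operator BigOperators
open Finset
open Literature.MathematicalPhysics.QuantumFieldTheory.Balaban1983to89
open Literature.MathematicalPhysics.QuantumFieldTheory.Balaban1983to89.T3ContinuumYM3Torus
open Literature.MathematicalPhysics.QuantumFieldTheory.Balaban1983to89.T3PrintedRegularMinimiser (RegPr)
open Literature.MathematicalPhysics.QuantumLattice (blockMap blockBase blockSites mem_blockSites_iff)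
open B7Prop1Explicit renaming Site → LSite
open B7Prop1Explicit (e hol seg treeWord l1 axialFn gaugeAct U1 mem_U1 Letter hol_mem axialFn_mem gaugeAct_mem axial_bond_bound length_treeWord
  norm_inv_sub_one_le hol_cons hol_nil stepHol stepHol_mem l1_add_le l1_vec)
open B7Prop2Explicit (avgIter pdev C0 c2' C0_pos c2'_pos AvgClosed le_pdev unitaryUnits)
open B7Eq78Linearization (conjR conjR_apply QprimeIter zdBlocking Qprime Qprime_apply QprimeIter_succ)
open B7AvgClosedSpecialUnitarySharp (avgClosed_specialUnitary_of_le_twentyone)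
open B7Eq47AveragedBondVsStraight (norm_avgIter_sub_straight_le)
open B7AvgGaugeCovariance (uLev pdev_gaugeAct)
open B8Eq119TwistedAxial (bgT)
open B8Eq143PlaqExpansion (norm_conjR_sub_self_le)
open B10Eq27TorusAxialLog (pull)
open T3SectALandauChart (bgUnits)
open Summit.QuantumFields.YangMills.Theorems.Prop7AxialReprPrint (pdev_pull_lt inAk_pull_of_regPr pull_toUField_mem)

open Summit.QuantumFields.YangMills.Theorems.Prop7CombAverageDefect

/-! ## §2 A field of print's class (52) in the comb axial gauge from the corner `c = Lᵏ•y` -/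

section Axial

variable {𝔸 : Type*} [NormedRing 𝔸] [NormOneClass 𝔸] [NormedAlgebra ℂ 𝔸] [CompleteSpace 𝔸] {d : ℕ}
  (L : ℕ) (hL : 2 ≤ L) {G : Subgroup 𝔸ˣ} (hG : AvgClosed d L G) (k : ℕ) (V : LSite d → Fin d → 𝔸ˣ) (hV : ∀ x κ, V x κ ∈ G)
  {α₀ : ℝ} (hα : 0 < α₀) (hα3 : C0 d * α₀ ≤ 1 / 3) (hα2 : 2 * α₀ ≤ c2' d L) (h52 : pdev V < α₀ * (((L : ℝ) ^ k)⁻¹) ^ 2)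

omit [NormOneClass 𝔸] [NormedAlgebra ℂ 𝔸] [CompleteSpace 𝔸] in
include hV in
/-- Gauge actions and comb gauges keep values in the subgroup. [folklore] -/
theorem gaugeAct_axialFn_mem_of (c x : LSite d) (μ : Fin d) : gaugeAct (axialFn V c) V x μ ∈ G :=
  G.mul_mem (G.mul_mem (B7Prop2Explicit.hol_mem_of hV _ _) (hV x μ)) (G.inv_mem (B7Prop2Explicit.hol_mem_of hV _ _))

include hG hV h52 in
/-- ★ **(κ) THE COMB-GAUGE FLATNESS** (pp. 24–25 «`|V₀,b − 1| < |b₋ − y|α₀`» at print's class (52)): in the axial gauge from ANY base point `c` every bond variable satisfies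
`‖V₀(x, μ) − 1‖ ≤ |x − c|₁·α₀η²`, `η = L^{−k}` — lit `axial_bond_bound` with the plaquette letter `pdev V < α₀η²`. [cite: Balaban1985Averaging, pp.24–25, (52) p.26] -/
theorem norm_gaugeAct_axialFn_sub_one_le (c x : LSite d) (μ : Fin d) :
    ‖((gaugeAct (axialFn V c) V x μ : 𝔸ˣ) : 𝔸) - 1‖ ≤ l1 (x - c) * (α₀ * (((L : ℝ) ^ k)⁻¹) ^ 2) := by
  have hV1 : ∀ x κ, V x κ ∈ U1 𝔸 := fun x κ => hG.le_U1 (hV x κ)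
  have h44 : ∀ (x : LSite d) (κ μ : Fin d), κ ≠ μ → ‖((hol V x (B7Prop1Explicit.plaqWord κ μ) : 𝔸ˣ) : 𝔸) - 1‖ ≤ α₀ * (((L : ℝ) ^ k)⁻¹) ^ 2 :=
    fun x κ μ _ => (le_pdev hV1 x κ μ).trans h52.le
  exact axial_bond_bound V hV1 c h44 (le_trans (B7Prop2Explicit.pdev_nonneg V) h52.le) x μ

include hL hG hV hα hα3 hα2 h52 in
/-- **THE AVERAGED BONDS IN THE COMB GAUGE, AFFINE LAW.**  With `c = Lᵏ•y` and `V₀ := (axialFn V c)•V`: for `j ≤ k` and every level-`j` bond `(w, κ)`,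
`‖Ū₀ʲ(w, κ) − 1‖ ≤ (256(d+1)(d+4) + 1)·α₀(Lʲη)² + α₀(Lʲη)²·|w − L^{k−j}y|₁` — lit's tower `‖Ūʲ − U(straight)‖ ≤ 256(d+1)(d+4)α₀(Lʲη)²` AT `V₀` (class (52) is gauge invariant)
plus (κ) integrated along the straight segment of `Lʲ` fine bonds from `Lʲw` (`|Lʲw − Lᵏy|₁ = Lʲ|w − L^{k−j}y|₁`). [cite: Balaban1985Averaging, (42)–(43) pp.23–24, pp.24–25, Prop. 2 (52)–(54) p.26] -/
theorem norm_avgIter_axial_sub_one_le (y : LSite d) {j : ℕ} (hj : j ≤ k) (w : LSite d) (κ : Fin d) :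
    ‖((avgIter L (gaugeAct (axialFn V (((L : ℤ) ^ k) • y)) V) j w κ : 𝔸ˣ) : 𝔸) - 1‖
      ≤ (256 * (d + 1) * (d + 4) + 1) * (α₀ * ((L : ℝ) ^ j * ((L : ℝ) ^ k)⁻¹) ^ 2)
        + (α₀ * ((L : ℝ) ^ j * ((L : ℝ) ^ k)⁻¹) ^ 2) * l1 (w - ((L : ℤ) ^ (k - j)) • y) := by
  set c : LSite d := ((L : ℤ) ^ k) • y with hc
  set V₀ := gaugeAct (axialFn V c) V with hV₀
  have hV1 : ∀ x κ, V x κ ∈ U1 𝔸 := fun x κ => hG.le_U1 (hV x κ)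
  have hu1 : ∀ x, axialFn V c x ∈ U1 𝔸 := fun x => axialFn_mem hV1 c x
  have hV₀G : ∀ x κ, V₀ x κ ∈ G := fun x κ => gaugeAct_axialFn_mem_of V hV c x κ
  have hV₀1 : ∀ x κ, V₀ x κ ∈ U1 𝔸 := fun x κ => hG.le_U1 (hV₀G x κ)
  have h52₀ : pdev V₀ < α₀ * (((L : ℝ) ^ k)⁻¹) ^ 2 := by rw [hV₀, pdev_gaugeAct hu1]; exact h52
  -- the tower at `V₀`
  have htow := norm_avgIter_sub_straight_le L hL hG k V₀ hV₀G hα hα3 hα2 h52₀ j hj w κ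
  -- the straight segment in the comb gauge
  have hb : ∀ (z : LSite d) (μ : Fin d), ‖((V₀ z μ : 𝔸ˣ) : 𝔸) - 1‖ ≤ 0 + (α₀ * (((L : ℝ) ^ k)⁻¹) ^ 2) * l1 (z - c) := by
    intro z μ
    rw [zero_add, mul_comm]
    exact norm_gaugeAct_axialFn_sub_one_le L hG k V hV h52 c z μ
  have hseg := norm_hol_sub_one_le_of_affine hV₀1 c le_rfl (by positivity) hb (seg κ ((L ^ j : ℕ) : ℤ)) (((L : ℤ) ^ j) • w)
  rw [B7Prop1Explicit.length_seg, Int.natAbs_natCast] at hseg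
  -- `|Lʲw − Lᵏy|₁ = Lʲ·|w − L^{k−j}y|₁`
  have hl1 : l1 (((L : ℤ) ^ j) • w - c) = L ^ j * l1 (w - ((L : ℤ) ^ (k - j)) • y) := by
    rw [hc, show ((L : ℤ) ^ k) = (L : ℤ) ^ j * (L : ℤ) ^ (k - j) by rw [← pow_add, Nat.add_sub_cancel' hj], ← smul_smul, ← smul_sub,
      show ((L : ℤ) ^ j) = ((L ^ j : ℕ) : ℤ) by push_cast; rfl, l1_natCast_smul]
  rw [hl1] at hseg
  have hLj : ((L ^ j : ℕ) : ℝ) = (L : ℝ) ^ j := by push_cast; rfl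
  have hratio : ((L : ℝ) ^ j * ((L : ℝ) ^ k)⁻¹) ^ 2 = (L : ℝ) ^ j * (L : ℝ) ^ j * (((L : ℝ) ^ k)⁻¹) ^ 2 := by ring
  have hl0 : (0 : ℝ) ≤ l1 (w - ((L : ℤ) ^ (k - j)) • y) := Nat.cast_nonneg _
  have hLj0 : (0 : ℝ) ≤ (L : ℝ) ^ j := by positivity
  calc ‖((avgIter L V₀ j w κ : 𝔸ˣ) : 𝔸) - 1‖
      ≤ ‖((avgIter L V₀ j w κ : 𝔸ˣ) : 𝔸) - ((hol V₀ (((L : ℤ) ^ j) • w) (seg κ ((L ^ j : ℕ) : ℤ)) : 𝔸ˣ) : 𝔸)‖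
          + ‖((hol V₀ (((L : ℤ) ^ j) • w) (seg κ ((L ^ j : ℕ) : ℤ)) : 𝔸ˣ) : 𝔸) - 1‖ := norm_sub_le_norm_sub_add_norm_sub _ _ _
    _ ≤ 256 * (d + 1) * (d + 4) * α₀ * ((L : ℝ) ^ j * ((L : ℝ) ^ k)⁻¹) ^ 2
          + (L ^ j : ℕ) * (0 + α₀ * (((L : ℝ) ^ k)⁻¹) ^ 2 * ((((L ^ j : ℕ) : ℕ) * l1 (w - ((L : ℤ) ^ (k - j)) • y) : ℕ) + (L ^ j : ℕ))) := add_le_add htow hseg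
    _ = _ := by push_cast; rw [hLj] at *; ring

include hL hG hV hα hα3 hα2 h52 in
/-- **THE LEVEL-`j` BLOCK TRANSPORTERS IN THE COMB GAUGE.**  For `j < k`, a level-`(j+1)` site `z` under `y` and `x′` in its `L`-block: the transporter `Ū₀ʲ(Γ_{Lz,x′})` of the averaged comb-gauged
background along the block contour (≤ `dL` level-`j` bonds, all within `d·L^{k−j}` of the corner in level-`j` units) satisfies
`‖T_j(z, x′) − 1‖ ≤ dL·((256(d+1)(d+4) + 1)a_j + a_j(dL^{k−j} + dL))`, `a_j = α₀(Lʲη)²`. [cite: Balaban1985Averaging, pp.24–25, (78)–(80) p.30, Prop. 2 (52)–(54) p.26] -/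
theorem norm_bgT_axial_sub_one_le (y : LSite d) {j : ℕ} (hj : j < k) (z : LSite d) (hz : blockMap (L ^ (k - 1 - j)) z = y) (x' : LSite d) (hx' : x' ∈ blockSites L z) :
    ‖((bgT L (gaugeAct (axialFn V (((L : ℤ) ^ k) • y)) V) j z x' : 𝔸ˣ) : 𝔸) - 1‖
      ≤ (d * L) * ((256 * (d + 1) * (d + 4) + 1) * (α₀ * ((L : ℝ) ^ j * ((L : ℝ) ^ k)⁻¹) ^ 2)
          + (α₀ * ((L : ℝ) ^ j * ((L : ℝ) ^ k)⁻¹) ^ 2) * (d * (L : ℝ) ^ (k - j) + d * L)) := by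
  haveI : NeZero L := ⟨by omega⟩
  have hL0 : 0 < L := by omega
  set V₀ := gaugeAct (axialFn V (((L : ℤ) ^ k) • y)) V with hV₀
  set a : ℝ := α₀ * ((L : ℝ) ^ j * ((L : ℝ) ^ k)⁻¹) ^ 2 with ha
  have ha0 : 0 ≤ a := by positivity
  have hV₀G : ∀ x κ, V₀ x κ ∈ G := fun x κ => gaugeAct_axialFn_mem_of V hV _ x κ
  have hV1 : ∀ x κ, V x κ ∈ U1 𝔸 := fun x κ => hG.le_U1 (hV x κ)
  have hu1 : ∀ x, axialFn V (((L : ℤ) ^ k) • y) x ∈ U1 𝔸 := fun x => axialFn_mem hV1 _ x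
  have h52₀ : pdev V₀ < α₀ * (((L : ℝ) ^ k)⁻¹) ^ 2 := by rw [hV₀, pdev_gaugeAct hu1]; exact h52
  have hWj1 : ∀ w κ, avgIter L V₀ j w κ ∈ U1 𝔸 := fun w κ =>
    hG.le_U1 (B7Prop2Explicit.avgIter_mem L hL hG k V₀ hV₀G hα hα3 hα2 h52₀ j hj.le w κ)
  -- the affine law of the level-`j` bonds, base point `q = L^{k−j} y`
  set q : LSite d := ((L : ℤ) ^ (k - j)) • y with hq
  have hb : ∀ (w : LSite d) (κ : Fin d), ‖((avgIter L V₀ j w κ : 𝔸ˣ) : 𝔸) - 1‖ ≤ (256 * (d + 1) * (d + 4) + 1) * a + a * l1 (w - q) :=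
    fun w κ => norm_avgIter_axial_sub_one_le L hL hG k V hV hα hα3 hα2 h52 y hj.le w κ
  -- the transporter is the holonomy along the block contour
  have hT : bgT L V₀ j z x' = hol (avgIter L V₀ j) (blockBase L z) (treeWord (x' - blockBase L z)) := rfl
  have haff := norm_hol_sub_one_le_of_affine hWj1 q (by positivity) ha0 hb (treeWord (x' - blockBase L z)) (blockBase L z)
  rw [length_treeWord] at haff
  -- geometry: word length `≤ d(L−1)`, base point within `L·d(L^{k−1−j} − 1)` of `q`
  have hbase : blockBase L z = (L : ℤ) • z := B9Eq333ProjectionCovarianceZd.blockBase_eq_smul L z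
  have hlen : (l1 (x' - blockBase L z) : ℝ) ≤ d * L := by
    have h := l1_sub_of_blockMap hL0 ((mem_blockSites_iff L z x').1 hx')
    rw [hbase]
    have : (l1 (x' - (L : ℤ) • z) : ℝ) ≤ d * (L - 1 : ℕ) := by exact_mod_cast h
    have h2 : ((L - 1 : ℕ) : ℝ) ≤ L := by exact_mod_cast Nat.sub_le L 1
    have hd : (0 : ℝ) ≤ d := Nat.cast_nonneg _
    nlinarith
  have hdist : (l1 (blockBase L z - q) : ℝ) ≤ d * (L : ℝ) ^ (k - j) := by
    have hm : blockMap (L ^ (k - 1 - j)) z = y := hz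
    have h := l1_sub_of_blockMap (pow_pos hL0 _) hm
    have e1 : blockBase L z - q = (L : ℤ) • (z - ((L ^ (k - 1 - j) : ℕ) : ℤ) • y) := by
      rw [hbase, hq, smul_sub, smul_smul, show ((L ^ (k - 1 - j) : ℕ) : ℤ) = (L : ℤ) ^ (k - 1 - j) by push_cast; rfl, ← pow_succ',
        show k - 1 - j + 1 = k - j by omega]
    rw [e1, show ((L : ℤ)) = ((L : ℕ) : ℤ) from rfl, l1_natCast_smul]
    have h' : ((L * l1 (z - ((L ^ (k - 1 - j) : ℕ) : ℤ) • y) : ℕ) : ℝ) ≤ L * (d * (L ^ (k - 1 - j) - 1 : ℕ)) := by exact_mod_cast Nat.mul_le_mul_left L h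
    refine h'.trans ?_
    have h3 : ((L ^ (k - 1 - j) - 1 : ℕ) : ℝ) ≤ (L : ℝ) ^ (k - 1 - j) := by exact_mod_cast Nat.sub_le _ 1
    have hd : (0 : ℝ) ≤ d := Nat.cast_nonneg _
    have hLr : (0 : ℝ) ≤ L := Nat.cast_nonneg _
    calc (L : ℝ) * (d * ((L ^ (k - 1 - j) - 1 : ℕ) : ℝ)) ≤ L * (d * (L : ℝ) ^ (k - 1 - j)) := by gcongr
      _ = d * (L : ℝ) ^ (k - j) := by rw [show k - j = (k - 1 - j) + 1 by omega, pow_succ]; ring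
  rw [hT]
  refine haff.trans ?_
  have hA0 : 0 ≤ (256 * (d + 1) * (d + 4) + 1) * a := by positivity
  have hl1n : (0 : ℝ) ≤ l1 (x' - blockBase L z) := Nat.cast_nonneg _
  have hl2n : (0 : ℝ) ≤ l1 (blockBase L z - q) := Nat.cast_nonneg _
  calc (l1 (x' - blockBase L z) : ℝ) * ((256 * (d + 1) * (d + 4) + 1) * a + a * (l1 (blockBase L z - q) + l1 (x' - blockBase L z)))
      ≤ (d * L) * ((256 * (d + 1) * (d + 4) + 1) * a + a * (d * (L : ℝ) ^ (k - j) + d * L)) := by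
        gcongr
    _ = _ := by rw [ha]

include hL hG hV hα hα3 hα2 h52 in
/-- ★★ **(θ) THE ITERATED COMB AVERAGE IN THE COMB GAUGE IS THE SCALAR WEIGHT UP TO `θ(d,L)·α₀`, k-UNIFORMLY.**  For `V` in print's class (52) (`pdev V < α₀η²`, `η = L^{−k}`, values in an
averaging-closed subgroup, the windows of Prop. 2), its comb gauge `V₀ := (axialFn V (Lᵏy))•V` from the corner of the `k`-block of `y`, every real `φ ≥ 0` and every `X`:
`‖(Q′_k(V₀)(φ•X))(y) − m•X‖ ≤ θ(d,L)·α₀·m·‖X‖`, `m = L^{−dk}Σ_{x∈Bᵏ(y)}φ(x)`, `θ(d,L) = 2dL(256(d+1)(d+4) + 1 + d(L+1))` — the level sum `Σ_{j<k}Lʲ∕Lᵏ ≤ 1` closes because the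
defects are AREAS `α₀(Lʲη)²` (Prop. 2), not bond counts. [cite: Balaban1985BackgroundPropagators, (3.18)–(3.19) p.393; Balaban1985Averaging, pp.24–25, Prop. 2 (52)–(54) p.26] -/
theorem norm_QprimeIter_axial_smul_sub_le (y : LSite d) (φ : LSite d → ℝ) (hφ : ∀ x, 0 ≤ φ x) (X : 𝔸) :
    ‖QprimeIter (zdBlocking d L) (bgT L (gaugeAct (axialFn V (((L : ℤ) ^ k) • y)) V)) k (fun x => φ x • X) y
        - ((((L : ℝ) ^ d)⁻¹) ^ k * ∑ x ∈ blockSites (L ^ k) y, φ x) • X‖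
      ≤ (2 * d * L * (256 * (d + 1) * (d + 4) + 1 + d * (L + 1))) * α₀ * ((((L : ℝ) ^ d)⁻¹) ^ k * ∑ x ∈ blockSites (L ^ k) y, φ x) * ‖X‖ := by
  haveI : NeZero L := ⟨by omega⟩
  have hL0 : 0 < L := by omega
  set V₀ := gaugeAct (axialFn V (((L : ℤ) ^ k) • y)) V with hV₀
  have hV₀G : ∀ x κ, V₀ x κ ∈ G := fun x κ => gaugeAct_axialFn_mem_of V hV _ x κ
  have hV1 : ∀ x κ, V x κ ∈ U1 𝔸 := fun x κ => hG.le_U1 (hV x κ)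
  have hu1 : ∀ x, axialFn V (((L : ℤ) ^ k) • y) x ∈ U1 𝔸 := fun x => axialFn_mem hV1 _ x
  have h52₀ : pdev V₀ < α₀ * (((L : ℝ) ^ k)⁻¹) ^ 2 := by rw [hV₀, pdev_gaugeAct hu1]; exact h52
  -- per-level defects
  set τ : ℕ → ℝ := fun j => (d * L) * ((256 * (d + 1) * (d + 4) + 1) * (α₀ * ((L : ℝ) ^ j * ((L : ℝ) ^ k)⁻¹) ^ 2)
      + (α₀ * ((L : ℝ) ^ j * ((L : ℝ) ^ k)⁻¹) ^ 2) * (d * (L : ℝ) ^ (k - j) + d * L)) with hτ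
  have hT1 : ∀ j < k, ∀ z : LSite d, blockMap (L ^ (k - 1 - j)) z = y → ∀ x' ∈ blockSites L z, bgT L V₀ j z x' ∈ U1 𝔸 := by
    intro j hj z _ x' _
    have hWj1 : ∀ w κ, avgIter L V₀ j w κ ∈ U1 𝔸 := fun w κ =>
      hG.le_U1 (B7Prop2Explicit.avgIter_mem L hL hG k V₀ hV₀G hα hα3 hα2 h52₀ j hj.le w κ)
    exact hol_mem hWj1 _ _
  have hτb : ∀ j < k, ∀ z : LSite d, blockMap (L ^ (k - 1 - j)) z = y → ∀ x' ∈ blockSites L z, ‖(bgT L V₀ j z x' : 𝔸) - 1‖ ≤ τ j :=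
    fun j hj z hz x' hx' => norm_bgT_axial_sub_one_le L hL hG k V hV hα hα3 hα2 h52 y hj z hz x' hx'
  have hmain := norm_QprimeIter_smul_sub_le hL0 V₀ k y τ hT1 hτb φ hφ X k le_rfl y (by
    rw [Nat.sub_self, pow_zero, Literature.MathematicalPhysics.QuantumLattice.blockMap_one])
  refine hmain.trans ?_
  have hm0 : 0 ≤ (((L : ℝ) ^ d)⁻¹) ^ k * ∑ x ∈ blockSites (L ^ k) y, φ x :=
    mul_nonneg (pow_nonneg (by positivity) _) (Finset.sum_nonneg fun x _ => hφ x)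
  refine mul_le_mul_of_nonneg_right (mul_le_mul_of_nonneg_right ?_ hm0) (norm_nonneg X)
  -- the level sum: `τ_j ≤ dL·(256(d+1)(d+4) + 1 + d + dL)·α₀·(Lʲ∕Lᵏ)` and `Σ_{j<k} Lʲ∕Lᵏ ≤ 1`
  have hLr : (2 : ℝ) ≤ L := by exact_mod_cast hL
  have hterm : ∀ j ∈ Finset.range k, 2 * τ j ≤ (2 * d * L * (256 * (d + 1) * (d + 4) + 1 + d * (L + 1))) * α₀ * ((L : ℝ) ^ j * ((L : ℝ) ^ k)⁻¹) := by
    intro j hj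
    rw [Finset.mem_range] at hj
    set r : ℝ := (L : ℝ) ^ j * ((L : ℝ) ^ k)⁻¹ with hr
    have hr0 : 0 ≤ r := by positivity
    have hr1 : r ≤ 1 := by
      rw [hr, ← div_eq_mul_inv, div_le_one (by positivity)]
      exact pow_le_pow_right₀ (by linarith) hj.le
    have hrL : r * (L : ℝ) ^ (k - j) = 1 := by
      rw [hr, show (L : ℝ) ^ k = (L : ℝ) ^ j * (L : ℝ) ^ (k - j) by rw [← pow_add, Nat.add_sub_cancel' hj.le]]
      field_simp
    have hr2 : r ^ 2 ≤ r := by nlinarith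
    have hr2L : r ^ 2 * (L : ℝ) ^ (k - j) = r := by rw [pow_two, mul_assoc, hrL, mul_one]
    have hd : (0 : ℝ) ≤ d := Nat.cast_nonneg _
    have hL0r : (0 : ℝ) ≤ L := Nat.cast_nonneg _
    have hC : (0 : ℝ) ≤ 256 * (d + 1) * (d + 4) + 1 := by positivity
    rw [hτ]
    show 2 * ((d * L) * ((256 * (d + 1) * (d + 4) + 1) * (α₀ * r ^ 2) + (α₀ * r ^ 2) * (d * (L : ℝ) ^ (k - j) + d * L)))
      ≤ (2 * d * L * (256 * (d + 1) * (d + 4) + 1 + d * (L + 1))) * α₀ * r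
    have e : (α₀ * r ^ 2) * (d * (L : ℝ) ^ (k - j) + d * L) = α₀ * d * r + α₀ * r ^ 2 * d * L := by
      calc (α₀ * r ^ 2) * (d * (L : ℝ) ^ (k - j) + d * L) = α₀ * d * (r ^ 2 * (L : ℝ) ^ (k - j)) + α₀ * r ^ 2 * d * L := by ring
        _ = _ := by rw [hr2L]
    rw [e]
    have hαr : α₀ * r ^ 2 ≤ α₀ * r := mul_le_mul_of_nonneg_left hr2 hα.le
    have hdL : (0 : ℝ) ≤ d * L := mul_nonneg hd hL0r
    have hbr : (256 * (d + 1) * (d + 4) + 1) * (α₀ * r ^ 2) + (α₀ * d * r + α₀ * r ^ 2 * d * L)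
        ≤ (256 * (d + 1) * (d + 4) + 1 + d * (L + 1)) * α₀ * r := by
      nlinarith [mul_le_mul_of_nonneg_left hαr hC, mul_le_mul_of_nonneg_left hαr hdL, mul_nonneg hα.le hr0]
    calc 2 * ((d * L) * ((256 * (d + 1) * (d + 4) + 1) * (α₀ * r ^ 2) + (α₀ * d * r + α₀ * r ^ 2 * d * L)))
        = 2 * (d * L) * ((256 * (d + 1) * (d + 4) + 1) * (α₀ * r ^ 2) + (α₀ * d * r + α₀ * r ^ 2 * d * L)) := by ring
      _ ≤ 2 * (d * L) * ((256 * (d + 1) * (d + 4) + 1 + d * (L + 1)) * α₀ * r) := mul_le_mul_of_nonneg_left hbr (by positivity)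
      _ = _ := by ring
  calc ∑ j ∈ Finset.range k, 2 * τ j ≤ ∑ j ∈ Finset.range k, (2 * d * L * (256 * (d + 1) * (d + 4) + 1 + d * (L + 1))) * α₀ * ((L : ℝ) ^ j * ((L : ℝ) ^ k)⁻¹) :=
        Finset.sum_le_sum hterm
    _ = (2 * d * L * (256 * (d + 1) * (d + 4) + 1 + d * (L + 1))) * α₀ * ∑ j ∈ Finset.range k, (L : ℝ) ^ j * ((L : ℝ) ^ k)⁻¹ := by rw [Finset.mul_sum]
    _ ≤ (2 * d * L * (256 * (d + 1) * (d + 4) + 1 + d * (L + 1))) * α₀ * 1 :=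
        mul_le_mul_of_nonneg_left (sum_pow_mul_inv_pow_le_one hL k) (by positivity)
    _ = _ := by ring

end Axial

/-! ## §3 The member: `V := pull (bgUnits F K U₀) x₀` at `U₀ ∈ RegPr(ε₀)` (`α₀ = 2ε₀`, `k = K − n`, `η = L^{−(K−n)}`) -/

section Member

variable (F : T3Family) (n K : ℕ)

/-- ★ **(κ) AT THE MEMBER**: for `U₀ ∈ 𝔘_k(ε₀)` (`RegPr`), the based pullback `U₀♯` in the comb axial gauge from ANY base point `c` has every bond within `|x − c|₁·2ε₀η²` of `1` — inside the `k`-block of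
the corner `c` this is `≤ 2dε₀η` («one power of η», the ribbon term of the bubble competitor). [cite: Balaban1985Averaging, pp.24–25; Balaban1985Variational, (2) p.278] -/
theorem norm_gaugeAct_axialFn_pull_sub_one_le_of_regPr {ε₀ : ℝ} (hε₀ : 0 < ε₀) {U₀ : GaugeField (F.P K) 0 (Matrix.specialUnitaryGroup (Fin 2) ℂ)}
    (hreg : RegPr F n K ε₀ U₀) (x₀ : Site (F.P K) 0) (c x : LSite (F.P K).d) (μ : Fin (F.P K).d) :
    ‖((gaugeAct (axialFn (pull (bgUnits F K U₀) x₀) c) (pull (bgUnits F K U₀) x₀) x μ : (Matrix (Fin 2) (Fin 2) ℂ)ˣ) : Matrix (Fin 2) (Fin 2) ℂ) - 1‖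
      ≤ l1 (x - c) * (2 * ε₀ * ((((F.P K).L : ℝ) ^ (K - n))⁻¹) ^ 2) := by
  have hG : AvgClosed (F.P K).d (F.P K).L (B7Prop2SpecialUnitary.specialUnitaryUnits (Fin 2)) :=
    avgClosed_specialUnitary_of_le_twentyone (by norm_num) _ _
  have hV : ∀ z κ, pull (bgUnits F K U₀) x₀ z κ ∈ B7Prop2SpecialUnitary.specialUnitaryUnits (Fin 2) := pull_toUField_mem U₀ x₀
  have h52 : pdev (pull (bgUnits F K U₀) x₀) < 2 * ε₀ * ((((F.P K).L : ℝ) ^ (K - n))⁻¹) ^ 2 :=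
    pdev_pull_lt hε₀ (inAk_pull_of_regPr F hε₀.le hreg) x₀
  exact norm_gaugeAct_axialFn_sub_one_le (F.P K).L hG (K - n) _ hV h52 c x μ

/-- ★★ **(θ) AT THE MEMBER**: for `U₀ ∈ 𝔘_k(ε₀)` with print's windows (`C₀(d)·2ε₀ ≤ ⅓`, `4ε₀ ≤ c₂′(d, L)`), the `k`-fold comb average of print's `Q′_k` ([B9] (3.19), lit `QprimeIter … (bgT …)`, the
letters of `IsLandauPrint`) of a real bump `φ ≥ 0` times a constant `X`, READ IN THE COMB GAUGE from the corner of the `k`-block of `y`, is `m•X` up to `θ(d,L)·2ε₀·m·‖X‖` — the bubble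
competitor's `M_y = m(1 + E_y)`, `‖E_y‖ ≤ θ(d,L)·2ε₀`, k-UNIFORM. [cite: Balaban1985BackgroundPropagators, (3.18)–(3.19) p.393; Balaban1985Averaging, Prop. 2 (52)–(54) p.26; Balaban1985Variational, (2) p.278, (21) p.281] -/
theorem norm_QprimeIter_axial_smul_sub_le_of_regPr {ε₀ : ℝ} (hε₀ : 0 < ε₀) (hε3 : C0 (F.P K).d * (2 * ε₀) ≤ 1 / 3) (hε2 : 2 * (2 * ε₀) ≤ c2' (F.P K).d (F.P K).L)
    {U₀ : GaugeField (F.P K) 0 (Matrix.specialUnitaryGroup (Fin 2) ℂ)} (hreg : RegPr F n K ε₀ U₀) (x₀ : Site (F.P K) 0)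
    (y : LSite (F.P K).d) (φ : LSite (F.P K).d → ℝ) (hφ : ∀ x, 0 ≤ φ x) (X : Matrix (Fin 2) (Fin 2) ℂ) :
    ‖QprimeIter (zdBlocking (F.P K).d (F.P K).L)
          (bgT (F.P K).L (gaugeAct (axialFn (pull (bgUnits F K U₀) x₀) ((((F.P K).L : ℤ) ^ (K - n)) • y)) (pull (bgUnits F K U₀) x₀))) (K - n)
          (fun x => φ x • X) y
        - (((((F.P K).L : ℝ) ^ (F.P K).d)⁻¹) ^ (K - n) * ∑ x ∈ blockSites ((F.P K).L ^ (K - n)) y, φ x) • X‖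
      ≤ (2 * (F.P K).d * (F.P K).L * (256 * ((F.P K).d + 1) * ((F.P K).d + 4) + 1 + (F.P K).d * ((F.P K).L + 1))) * (2 * ε₀)
          * (((((F.P K).L : ℝ) ^ (F.P K).d)⁻¹) ^ (K - n) * ∑ x ∈ blockSites ((F.P K).L ^ (K - n)) y, φ x) * ‖X‖ := by
  have hG : AvgClosed (F.P K).d (F.P K).L (B7Prop2SpecialUnitary.specialUnitaryUnits (Fin 2)) :=
    avgClosed_specialUnitary_of_le_twentyone (by norm_num) _ _
  have hV : ∀ z κ, pull (bgUnits F K U₀) x₀ z κ ∈ B7Prop2SpecialUnitary.specialUnitaryUnits (Fin 2) := pull_toUField_mem U₀ x₀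
  have h52 : pdev (pull (bgUnits F K U₀) x₀) < 2 * ε₀ * ((((F.P K).L : ℝ) ^ (K - n))⁻¹) ^ 2 :=
    pdev_pull_lt hε₀ (inAk_pull_of_regPr F hε₀.le hreg) x₀
  exact norm_QprimeIter_axial_smul_sub_le (F.P K).L (F.P K).hL.2 hG (K - n) _ hV (by positivity) hε3 hε2 h52 y φ hφ X

/-- ★ **(θ′) THE GAUGE READING**: the `k`-fold comb average of the ORIGINAL background applied to the comb-rotated datum `φ•R(σ_x)⁻¹X` equals the comb average of the comb-gauged background
applied to the plain datum `φ•X` (`σ = axialFn V (Lᵏy)`, `σ(Lᵏy) = 1`; lit's (3.32) `QprimeIter_gaugeAct`) — so the competitor's `M_y` may be written with either background.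
[cite: Balaban1985BackgroundPropagators, (3.19) p.393, (3.32) p.395] -/
theorem QprimeIter_axial_eq_conjR (L : ℕ) (k : ℕ) (V : LSite (F.P K).d → Fin (F.P K).d → (Matrix (Fin 2) (Fin 2) ℂ)ˣ) (y : LSite (F.P K).d) (φ : LSite (F.P K).d → ℝ) (X : Matrix (Fin 2) (Fin 2) ℂ) :
    QprimeIter (zdBlocking (F.P K).d L) (bgT L (gaugeAct (axialFn V (((L : ℤ) ^ k) • y)) V)) k (fun x => φ x • X) y
      = QprimeIter (zdBlocking (F.P K).d L) (bgT L V) k (fun x => φ x • conjR (axialFn V (((L : ℤ) ^ k) • y) x)⁻¹ X) y := by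
  letI : CStarAlgebra (Matrix (Fin 2) (Fin 2) ℂ) := {}
  have h := B9Eq333ProjectionCovarianceZd.QprimeIter_gaugeAct L (axialFn V (((L : ℤ) ^ k) • y)) V k
    (fun x => φ x • conjR (axialFn V (((L : ℤ) ^ k) • y) x)⁻¹ X) y
  have hlam : (fun z => conjR (axialFn V (((L : ℤ) ^ k) • y) z) (φ z • conjR (axialFn V (((L : ℤ) ^ k) • y) z)⁻¹ X)) = fun z => φ z • X := by
    funext z
    rw [B7Eq78Linearization.conjR_smul_real, B8Ineq132.conjR_conjR, mul_inv_cancel, B8Ineq132.one_conjR]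
  have hu : uLev L (axialFn V (((L : ℤ) ^ k) • y)) k y = 1 := by
    show hol V (((L : ℤ) ^ k) • y) (treeWord ((((L : ℤ) ^ k) • y) - (((L : ℤ) ^ k) • y))) = 1
    rw [sub_self, B7Prop1Explicit.treeWord_zero, hol_nil]
  rw [hlam, hu, B8Ineq132.one_conjR] at h
  exact h

end Member

end Summit.QuantumFields.YangMills.Theorems.Prop7CombDefectRowsOfRegPr

end
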